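import Literature.AlgebraicGeometry.Modules.TildePullbackUnit
import Literature.AlgebraicGeometry.Modules.PullbackUnitComp
import Literature.AlgebraicGeometry.Modules.PullbackUnitSections
import Literature.AlgebraicGeometry.Modules.KernelFiniteLocallyFree
import Literature.AlgebraicGeometry.Modules.CohFinitePresentation
import HarnessLib

/-!
# Sections of an inverse image over an affine open: `Γ(U, f^*M) = Γ(U, 𝒪_X) ⊗_{Γ(V, 𝒪_Y)} Γ(V, M)`

Görtz–Wedhorn, *Algebraic Geometry I* (2nd ed. 2020), Prop. 7.24 (2) / Remark 7.25, and
Hartshorne, *Algebraic Geometry*, II Prop. 5.2 (e): "`f^*(M~) ≅ (B ⊗_A M)~`" for a morphism of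
affine schemes; hence, for an arbitrary morphism `f : X → Y`, affine opens `U ⊆ X`, `V ⊆ Y` with
`f(U) ⊆ V` and a quasi-coherent `𝒪_Y`-module `M`, **the sections of `f^*M` over `U` are
`Γ(U, 𝒪_X) ⊗_{Γ(V, 𝒪_Y)} Γ(V, M)`, the pulled-back section `η(m)|_U` corresponding to `1 ⊗ m`.**

This file proves this for Mathlib's abstract `Scheme.Modules.pullback` (a left adjoint, with no
sections formula) and the tree's affine-localizing modules:

* `unitSectionLE f M i m` — the section `η(m)|_U ∈ Γ(U, f^*M)` of a section `m ∈ Γ(V, M)`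
  (`PullbackUnitSections.unitSection` restricted along `i : U ≤ f⁻¹V`), additive and
  `f♯`-semilinear (`unitSectionLE_smul`);
* `chartAlgebra`, `chartModule` — `Γ(U, 𝒪_X)` as a `Γ(V, 𝒪_Y)`-algebra through
  `f.appLE V U i`, and the induced `Γ(V, 𝒪_Y)`-module structure on `Γ(U, f^*M)`;
* **`liftBaseChange_unitSectionLE_bijective`** — for `M` affine-localizing, the `Γ(U)`-linear map
  `Γ(U) ⊗_{Γ(V)} Γ(V, M) → Γ(U, f^*M)`, `c ⊗ m ↦ c·η(m)|_U`, is BIJECTIVE. Proof: on the affine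
  chart `Spec Γ(U) → Spec Γ(V)` the module `(f^*M)|_{Spec Γ(U)}` is
  `(Spec f♯)^*(M|_{Spec Γ(V)}) = (Spec f♯)^*(Γ(V, M)~) = (Γ(U) ⊗ Γ(V, M))~` (pseudofunctoriality of
  `f^*`, Mathlib `pullbackComp`/`pullbackCongr`; `M|_{Spec Γ(V)} = Γ(V, M)~` for `M`
  affine-localizing, `isLocalizing_restrict_fromSpec`; `TildePullback`), and the pulled-back
  sections are tracked through each identification (`PullbackUnitComp`, `TildePullbackUnit`).

Everything is proved; no named facts.

## References

* U. Görtz, T. Wedhorn, *Algebraic Geometry I: Schemes*, 2nd ed., Springer Spektrum (2020),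
  Prop. 7.24 (2), Rem. 7.25. [GortzWedhorn2020]
* R. Hartshorne, *Algebraic Geometry*, GTM 52 (1977), II Prop. 5.2 (e) (p. 110). [Hartshorne1977]
* The Stacks Project, Tag 01I8 (pullback of quasi-coherent modules on affines). [StacksProject]
-/

noncomputable section

-- `TopCat.Presheaf`/`Scheme.Modules` are not reducible (as in Mathlib's `AlgebraicGeometry/Modules`).
set_option backward.isDefEq.respectTransparency false

open CategoryTheory AlgebraicGeometry Limits TopologicalSpace Opposite TensorProduct
open scoped ChangeOfRings

universe u

namespace Literature.AlgebraicGeometry.Modules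

open Literature.AlgebraicGeometry.Motives

variable {X Y : Scheme.{u}} (f : X ⟶ Y) (M : Y.Modules) {V : Y.Opens} (hV : IsAffineOpen V)
  {U : X.Opens} (hU : IsAffineOpen U) (i : U ≤ f ⁻¹ᵁ V)

/-! ### Pulled-back sections restricted to `U` -/

/-- **The section `η(m)|_U ∈ Γ(U, f^*M)`** of `m ∈ Γ(V, M)`, for `U ⊆ f⁻¹V`.
[cite: Hartshorne1977, II.5 (p. 110)] -/
def unitSectionLE (m : Γ(M, V)) : Γ((Scheme.Modules.pullback f).obj M, U) :=
  ((Scheme.Modules.pullback f).obj M).presheaf.map (homOfLE i).op (unitSection f M V m)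

/-- `η(m + m')|_U = η(m)|_U + η(m')|_U`. [folklore] -/
theorem unitSectionLE_add (m m' : Γ(M, V)) :
    unitSectionLE f M i (m + m') = unitSectionLE f M i m + unitSectionLE f M i m' := by
  rw [unitSectionLE, unitSection_add, map_add]; rfl

/-- `η(r·m)|_U = f♯(r)|_U · η(m)|_U`. [folklore] -/
theorem unitSectionLE_smul (r : Γ(Y, V)) (m : Γ(M, V)) :
    unitSectionLE f M i (r • m) = f.appLE V U i r • unitSectionLE f M i m := by
  rw [unitSectionLE, unitSection_smul, Scheme.Modules.map_smul, Scheme.Hom.appLE]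
  rfl

/-! ### The affine chart `Spec Γ(U) → Spec Γ(V)` and the module `(f^*M)|_{Spec Γ(U)}` -/

section Chart

/-- The ring map `f♯ : Γ(V, 𝒪_Y) → Γ(U, 𝒪_X)` of the chart. [folklore] -/
abbrev chartHom : Γ(Y, V) ⟶ Γ(X, U) := f.appLE V U i

/-- The global sections of `M|_{Spec Γ(V)}`, as a `Γ(V)`-module (Mathlib's `Spec`-sections module
structure). [folklore] -/
abbrev restrictTop (M : Y.Modules) (hV : IsAffineOpen V) : ModuleCat.{u} Γ(Y, V) :=
  (modulesSpecToSheaf.obj (M.restrict hV.fromSpec)).presheaf.obj (op ⊤)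

/-- The chart square: `Spec Γ(U) → Spec Γ(V) → Y` is `Spec Γ(U) → X → Y`. [folklore] -/
theorem chart_comm : hU.fromSpec ≫ f = Spec.map (chartHom f i) ≫ hV.fromSpec :=
  (IsAffineOpen.SpecMap_appLE_fromSpec f hV hU i).symm

/-- **`M|_{Spec Γ(V)} ≅ Γ(V, M)~`** for `M` affine-localizing (Mathlib `fromTildeΓ`, an isomorphism
by `isLocalizing_restrict_fromSpec`). [cite: Hartshorne1977, II Prop. 5.4 (p. 113)] -/
def restrictFromSpecIsoTilde (hM : IsAffineLocalizing M) :
    M.restrict hV.fromSpec ≅ tilde (restrictTop M hV) :=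
  haveI : IsIso (M.restrict hV.fromSpec).fromTildeΓ :=
    (isIso_fromTildeΓ_iff_isLocalizing _).mpr (isLocalizing_restrict_fromSpec M hM hV)
  (asIso (M.restrict hV.fromSpec).fromTildeΓ).symm

/-- **`g_V^* M ≅ Γ(V, M)~`** (`g_V : Spec Γ(V) → Y` the chart): inverse image along the open
immersion is restriction. [folklore] -/
def pullbackFromSpecIsoTilde (hM : IsAffineLocalizing M) :
    (Scheme.Modules.pullback hV.fromSpec).obj M ≅ tilde (restrictTop M hV) :=
  ((Scheme.Modules.restrictFunctorIsoPullback hV.fromSpec).app M).symm ≪≫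
    restrictFromSpecIsoTilde M hV hM

/-- **The chart isomorphism `(f^*M)|_{Spec Γ(U)} ≅ (Γ(U) ⊗_{Γ(V)} Γ(V, M))~`** (GW I Prop. 7.24 (2)
on the chart, via the pseudofunctoriality of inverse images).
[cite: GortzWedhorn2020, Prop 7.24 (2)] [cite: Hartshorne1977, II Prop. 5.2 (e) (p. 110)] -/
def chartIso (hM : IsAffineLocalizing M) :
    ((Scheme.Modules.pullback f).obj M).restrict hU.fromSpec ≅
      tilde ((ModuleCat.extendScalars.{u, u, u} (chartHom f i).hom).obj (restrictTop M hV)) :=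
  (Scheme.Modules.restrictFunctorIsoPullback hU.fromSpec).app _ ≪≫
    (Scheme.Modules.pullbackComp hU.fromSpec f).app M ≪≫
    (Scheme.Modules.pullbackCongr (chart_comm f hV hU i)).app M ≪≫
    ((Scheme.Modules.pullbackComp (Spec.map (chartHom f i)) hV.fromSpec).app M).symm ≪≫
    (Scheme.Modules.pullback (Spec.map (chartHom f i))).mapIso (pullbackFromSpecIsoTilde M hV hM) ≪≫
    pullbackTildeIso (chartHom f i) (restrictTop M hV)

end Chart

/-! ### Tracking the pulled-back sections through the chart isomorphism -/

section Chase

/-- Restriction maps of a module along two parallel morphisms of opens agree. [folklore] -/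
theorem presheaf_map_congr (N : X.Modules) {W W' : X.Opens} (j j' : W' ⟶ W) (x : Γ(N, W)) :
    N.presheaf.map j.op x = N.presheaf.map j'.op x := by
  rw [Subsingleton.elim j j']

/-- **Step 1**: `restrictFunctorIsoPullback` sends the restricted section `x|_{g(g⁻¹W)}` to the
pulled-back section `η_g(x)`. [folklore] -/
theorem restrictFunctorIsoPullback_hom_app_map {X' : Scheme.{u}} (g : X' ⟶ X) [IsOpenImmersion g]
    (N : X.Modules) (W : X.Opens) (x : Γ(N, W)) :
    ((Scheme.Modules.restrictFunctorIsoPullback g).hom.app N).app (g ⁻¹ᵁ W)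
      (N.presheaf.map (homOfLE (g.image_preimage_le W)).op x) = unitSection g N W x := by
  have h := Adjunction.unit_leftAdjointUniq_hom_app (Scheme.Modules.restrictAdjunction g)
    (Scheme.Modules.pullbackPushforwardAdjunction g) N
  have h' := congrArg (fun φ => (Scheme.Modules.Hom.app φ W) x) h
  simp only [Scheme.Modules.Hom.comp_app] at h'
  exact h'

/-- **Step 2**: `pullbackComp` sends `η_g(η_f(m))` to `η_{g ≫ f}(m)`. [folklore] -/
theorem pullbackComp_hom_app_unitSection {X' : Scheme.{u}} (g : X' ⟶ X) (V : Y.Opens) (m : Γ(M, V)) :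
    ((Scheme.Modules.pullbackComp g f).hom.app M).app (g ⁻¹ᵁ (f ⁻¹ᵁ V))
      (unitSection g ((Scheme.Modules.pullback f).obj M) (f ⁻¹ᵁ V) (unitSection f M V m)) =
      unitSection (g ≫ f) M V m := by
  have h := unit_comp_map_pullbackComp_inv g f M
  have h' := congrArg (fun φ => (Scheme.Modules.Hom.app φ V) m) h
  simp only [Scheme.Modules.Hom.comp_app] at h'
  change ((Scheme.Modules.pullbackComp g f).inv.app M).app _ (unitSection (g ≫ f) M V m) =
    unitSection g _ (f ⁻¹ᵁ V) (unitSection f M V m) at h'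
  have hid := congrArg
    (fun φ => Scheme.Modules.Hom.app φ (g ⁻¹ᵁ (f ⁻¹ᵁ V)) (unitSection (g ≫ f) M V m))
    ((Scheme.Modules.pullbackComp g f).inv_hom_id_app M)
  change ((Scheme.Modules.pullbackComp g f).hom.app M).app _
    (((Scheme.Modules.pullbackComp g f).inv.app M).app _ (unitSection (g ≫ f) M V m)) = _ at hid
  rw [h'] at hid
  exact hid

/-- **Step 2'**: `pullbackComp⁻¹` sends `η_{g ≫ f}(m)` to `η_g(η_f(m))`. [folklore] -/
theorem pullbackComp_inv_app_unitSection {X' : Scheme.{u}} (g : X' ⟶ X) (V : Y.Opens) (m : Γ(M, V)) :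
    ((Scheme.Modules.pullbackComp g f).inv.app M).app (g ⁻¹ᵁ (f ⁻¹ᵁ V))
      (unitSection (g ≫ f) M V m) =
      unitSection g ((Scheme.Modules.pullback f).obj M) (f ⁻¹ᵁ V) (unitSection f M V m) := by
  have h := unit_comp_map_pullbackComp_inv g f M
  have h' := congrArg (fun φ => (Scheme.Modules.Hom.app φ V) m) h
  simp only [Scheme.Modules.Hom.comp_app] at h'
  exact h'

/-- **Step 3**: `pullbackCongr` sends `η_{f₁}(m)` to `η_{f₂}(m)` (`f₁ = f₂`). [folklore] -/
theorem pullbackCongr_hom_app_unitSection {f₁ f₂ : X ⟶ Y} (h : f₁ = f₂) (V : Y.Opens) (m : Γ(M, V)) :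
    ((Scheme.Modules.pullbackCongr h).hom.app M).app (f₁ ⁻¹ᵁ V) (unitSection f₁ M V m) =
      ((Scheme.Modules.pullback f₂).obj M).presheaf.map (eqToHom (by rw [h])).op
        (unitSection f₂ M V m) := by
  subst h
  simp only [eqToHom_refl, op_id, CategoryTheory.Functor.map_id]
  rfl

/-- **Step 5**: `(pullback g).map φ` sends `η_g(y)` to `η_g(φ y)` (naturality of the unit). [folklore] -/
theorem pullback_map_app_unitSection {X' : Scheme.{u}} (g : X' ⟶ X) {A B : X.Modules} (φ : A ⟶ B)
    (W : X.Opens) (y : Γ(A, W)) :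
    ((Scheme.Modules.pullback g).map φ).app (g ⁻¹ᵁ W) (unitSection g A W y) =
      unitSection g B W (φ.app W y) := by
  have h := (Scheme.Modules.pullbackPushforwardAdjunction g).unit_naturality φ
  have h' := congrArg (fun ψ => (Scheme.Modules.Hom.app ψ W) y) h
  simp only [Scheme.Modules.Hom.comp_app] at h'
  exact h'

/-- **Step 5'**: `M|_{Spec Γ(V)} ≅ Γ(V, M)~` sends the restriction `m|_{W}` of a global section of
`M|_{Spec Γ(V)}` to `toOpen m`. [folklore] -/
theorem restrictFromSpecIsoTilde_hom_app_map (hM : IsAffineLocalizing M)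
    (W : (Spec Γ(Y, V)).Opens) (m : restrictTop M hV) :
    (restrictFromSpecIsoTilde M hV hM).hom.app W
      ((M.restrict hV.fromSpec).presheaf.map (homOfLE le_top).op m) = tilde.toOpen _ W m := by
  haveI : IsIso (M.restrict hV.fromSpec).fromTildeΓ :=
    (isIso_fromTildeΓ_iff_isLocalizing _).mpr (isLocalizing_restrict_fromSpec M hM hV)
  have h := Scheme.Modules.toOpen_fromTildeΓ_app (M.restrict hV.fromSpec) W
  have h' := congrArg (fun ψ => (ModuleCat.Hom.hom ψ) m) h
  simp only [ModuleCat.hom_comp, LinearMap.comp_apply] at h'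
  -- `h' : fromTildeΓ (toOpen m) = m|_W`; the isomorphism is `(asIso fromTildeΓ).symm`
  have h'' : (asIso (M.restrict hV.fromSpec).fromTildeΓ).hom.app W (tilde.toOpen _ W m) =
      (M.restrict hV.fromSpec).presheaf.map (homOfLE le_top).op m := h'
  rw [← h'']
  exact inv_app_hom_app (asIso (M.restrict hV.fromSpec).fromTildeΓ) W _

/-- **Step 5''**: `g_V^*M ≅ Γ(V, M)~` sends `η_{g_V}(m)` to `toOpen m'`, `m'` the global section of
`M|_{Spec Γ(V)}` given by `m`. [folklore] -/
theorem pullbackFromSpecIsoTilde_hom_app_unitSection (hM : IsAffineLocalizing M) (m : Γ(M, V)) :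
    (pullbackFromSpecIsoTilde M hV hM).hom.app (hV.fromSpec ⁻¹ᵁ V) (unitSection hV.fromSpec M V m) =
      tilde.toOpen _ (hV.fromSpec ⁻¹ᵁ V) (appTopRestrictFromSpecEquiv M hV m) := by
  have h1 := restrictFunctorIsoPullback_hom_app_map hV.fromSpec M V m
  have h2 : ((Scheme.Modules.restrictFunctorIsoPullback hV.fromSpec).app M).inv.app _
      (unitSection hV.fromSpec M V m) =
      M.presheaf.map (homOfLE (hV.fromSpec.image_preimage_le V)).op m := by
    rw [← h1]
    exact inv_app_hom_app _ _ _
  have h3 : M.presheaf.map (homOfLE (hV.fromSpec.image_preimage_le V)).op m =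
      (M.restrict hV.fromSpec).presheaf.map (homOfLE (le_top (a := hV.fromSpec ⁻¹ᵁ V))).op
        (appTopRestrictFromSpecEquiv M hV m) := by
    change M.presheaf.map _ m = M.presheaf.map _ (M.presheaf.map _ m)
    rw [← CategoryTheory.comp_apply, ← M.presheaf.map_comp]
    exact presheaf_map_congr M _ _ m
  rw [pullbackFromSpecIsoTilde, Iso.trans_hom, Scheme.Modules.Hom.comp_app, Iso.symm_hom,
    Iso.app_inv]
  change (restrictFromSpecIsoTilde M hV hM).hom.app _
    (((Scheme.Modules.restrictFunctorIsoPullback hV.fromSpec).app M).inv.app _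
      (unitSection hV.fromSpec M V m)) = _
  rw [h2, h3]
  exact restrictFromSpecIsoTilde_hom_app_map M hV hM _ _

/-- **Step 6**: `(Spec φ)^*(P~) ≅ (S ⊗ P)~` sends `η(toOpen p)` to `toOpen (1 ⊗ p)` over any open
`W` with `W = ⊤`... stated over `(Spec φ)⁻¹ W` for `W` an open of `Spec R` equal to `⊤`. [folklore] -/
theorem pullbackTildeIso_hom_app_unitSection {R S : CommRingCat.{u}} (φ : R ⟶ S) (P : ModuleCat.{u} R)
    (W : (Spec R).Opens) (hW : W = ⊤) (p : P) :
    (pullbackTildeIso φ P).hom.app (Spec.map φ ⁻¹ᵁ W)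
      (unitSection (Spec.map φ) (tilde P) W (tilde.toOpen P W p)) =
      tilde.toOpen ((ModuleCat.extendScalars.{u, u, u} φ.hom).obj P) (Spec.map φ ⁻¹ᵁ W)
        ((1 : S) ⊗ₜ[R, φ.hom] p) := by
  subst hW
  exact pullbackTildeIso_unit_toOpen_top φ P p

/-- The open `g_U⁻¹(f⁻¹V) = (g_U ≫ f)⁻¹V` of `Spec Γ(U)` equals `(Spec f♯ ≫ g_V)⁻¹V`. [folklore] -/
theorem chart_preimage_eq :
    hU.fromSpec ⁻¹ᵁ (f ⁻¹ᵁ V) = Spec.map (chartHom f i) ⁻¹ᵁ (hV.fromSpec ⁻¹ᵁ V) := by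
  change (hU.fromSpec ≫ f) ⁻¹ᵁ V = (Spec.map (chartHom f i) ≫ hV.fromSpec) ⁻¹ᵁ V
  rw [chart_comm f hV hU i]

/-- **The chart isomorphism on pulled-back sections**: `chartIso` sends the restriction of `η_f(m)`
to `Spec Γ(U)` (over `g_U⁻¹(f⁻¹V)`) to `toOpen (1 ⊗ m')`, where `m' ∈ Γ(M|_{Spec Γ(V)}, ⊤)` is `m`.
[cite: GortzWedhorn2020, Prop 7.24 (2) (proof)] -/
theorem chartIso_hom_app_unit (hM : IsAffineLocalizing M) (m : Γ(M, V)) :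
    (chartIso f M hV hU i hM).hom.app (hU.fromSpec ⁻¹ᵁ (f ⁻¹ᵁ V))
      (((Scheme.Modules.pullback f).obj M).presheaf.map
        (homOfLE (hU.fromSpec.image_preimage_le (f ⁻¹ᵁ V))).op (unitSection f M V m)) =
      tilde.toOpen ((ModuleCat.extendScalars.{u, u, u} (chartHom f i).hom).obj (restrictTop M hV))
        (hU.fromSpec ⁻¹ᵁ (f ⁻¹ᵁ V))
        ((1 : Γ(X, U)) ⊗ₜ[Γ(Y, V), (chartHom f i).hom] (appTopRestrictFromSpecEquiv M hV m)) := by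
  have hWW₂ := chart_preimage_eq f hV hU i
  have hW₂top : hV.fromSpec ⁻¹ᵁ V = ⊤ := hV.fromSpec_preimage_self
  -- unfold the composite
  simp only [chartIso, Iso.trans_hom, Scheme.Modules.Hom.comp_app, Iso.app_hom, Iso.symm_hom,
    Functor.mapIso_hom, Iso.app_inv]
  change (pullbackTildeIso (chartHom f i) (restrictTop M hV)).hom.app _
    (((Scheme.Modules.pullback (Spec.map (chartHom f i))).map (pullbackFromSpecIsoTilde M hV hM).hom).app _
      (((Scheme.Modules.pullbackComp (Spec.map (chartHom f i)) hV.fromSpec).inv.app M).app _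
        (((Scheme.Modules.pullbackCongr (chart_comm f hV hU i)).hom.app M).app _
          (((Scheme.Modules.pullbackComp hU.fromSpec f).hom.app M).app _
            (((Scheme.Modules.restrictFunctorIsoPullback hU.fromSpec).hom.app _).app _
              (((Scheme.Modules.pullback f).obj M).presheaf.map
                (homOfLE (hU.fromSpec.image_preimage_le (f ⁻¹ᵁ V))).op (unitSection f M V m))))))) = _
  have s1 := restrictFunctorIsoPullback_hom_app_map hU.fromSpec ((Scheme.Modules.pullback f).obj M)
    (f ⁻¹ᵁ V) (unitSection f M V m)
  have s2 := pullbackComp_hom_app_unitSection f M hU.fromSpec V m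
  have s3 : ((Scheme.Modules.pullbackCongr (chart_comm f hV hU i)).hom.app M).app
      (hU.fromSpec ⁻¹ᵁ (f ⁻¹ᵁ V)) (unitSection (hU.fromSpec ≫ f) M V m) = _ :=
    pullbackCongr_hom_app_unitSection M (chart_comm f hV hU i) V m
  rw [s1, s2, s3]
  -- restate with the opens `O₁ = g_U⁻¹(f⁻¹V)`, `O₂ = (Spec f♯)⁻¹(g_V⁻¹V)` and move the transport out
  change (pullbackTildeIso (chartHom f i) (restrictTop M hV)).hom.app (hU.fromSpec ⁻¹ᵁ (f ⁻¹ᵁ V))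
    (((Scheme.Modules.pullback (Spec.map (chartHom f i))).map (pullbackFromSpecIsoTilde M hV hM).hom).app
      (hU.fromSpec ⁻¹ᵁ (f ⁻¹ᵁ V))
      (((Scheme.Modules.pullbackComp (Spec.map (chartHom f i)) hV.fromSpec).inv.app M).app
        (hU.fromSpec ⁻¹ᵁ (f ⁻¹ᵁ V))
        (((Scheme.Modules.pullback (Spec.map (chartHom f i) ≫ hV.fromSpec)).obj M).presheaf.map
          (eqToHom hWW₂).op (unitSection (Spec.map (chartHom f i) ≫ hV.fromSpec) M V m)))) = _
  rw [Scheme.Modules.Hom.app_map_apply]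
  change (pullbackTildeIso (chartHom f i) (restrictTop M hV)).hom.app (hU.fromSpec ⁻¹ᵁ (f ⁻¹ᵁ V))
    (((Scheme.Modules.pullback (Spec.map (chartHom f i))).map (pullbackFromSpecIsoTilde M hV hM).hom).app
      (hU.fromSpec ⁻¹ᵁ (f ⁻¹ᵁ V))
      (((Scheme.Modules.pullback (Spec.map (chartHom f i))).obj
          ((Scheme.Modules.pullback hV.fromSpec).obj M)).presheaf.map (eqToHom hWW₂).op
        ((((Scheme.Modules.pullbackComp (Spec.map (chartHom f i)) hV.fromSpec).inv.app M).app
          (Spec.map (chartHom f i) ⁻¹ᵁ (hV.fromSpec ⁻¹ᵁ V))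
          (unitSection (Spec.map (chartHom f i) ≫ hV.fromSpec) M V m))))) = _
  rw [Scheme.Modules.Hom.app_map_apply, Scheme.Modules.Hom.app_map_apply]
  have s4 : ((Scheme.Modules.pullbackComp (Spec.map (chartHom f i)) hV.fromSpec).inv.app M).app
      (Spec.map (chartHom f i) ⁻¹ᵁ (hV.fromSpec ⁻¹ᵁ V))
      (unitSection (Spec.map (chartHom f i) ≫ hV.fromSpec) M V m) =
      unitSection (Spec.map (chartHom f i)) _ (hV.fromSpec ⁻¹ᵁ V) (unitSection hV.fromSpec M V m) :=
    pullbackComp_inv_app_unitSection hV.fromSpec M (Spec.map (chartHom f i)) V m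
  have s5 := pullback_map_app_unitSection (Spec.map (chartHom f i))
    (pullbackFromSpecIsoTilde M hV hM).hom (hV.fromSpec ⁻¹ᵁ V) (unitSection hV.fromSpec M V m)
  have s6 := pullbackFromSpecIsoTilde_hom_app_unitSection M hV hM m
  have s7 := pullbackTildeIso_hom_app_unitSection (chartHom f i) (restrictTop M hV)
    (hV.fromSpec ⁻¹ᵁ V) hW₂top (appTopRestrictFromSpecEquiv M hV m)
  rw [s4, s5, s6, s7]
  -- `toOpen` is compatible with restriction
  have s8 := congrArg (fun φ => (ModuleCat.Hom.hom φ)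
      ((1 : Γ(X, U)) ⊗ₜ[Γ(Y, V), (chartHom f i).hom] (appTopRestrictFromSpecEquiv M hV m)))
    (tilde.toOpen_res ((ModuleCat.extendScalars.{u, u, u} (chartHom f i).hom).obj (restrictTop M hV))
      (Spec.map (chartHom f i) ⁻¹ᵁ (hV.fromSpec ⁻¹ᵁ V)) (hU.fromSpec ⁻¹ᵁ (f ⁻¹ᵁ V)) (eqToHom hWW₂))
  simp only [ModuleCat.hom_comp, LinearMap.comp_apply] at s8
  exact s8

end Chase



/-! ### Global sections of the chart: `Γ(U, f^*M) ≃ Γ(U) ⊗_{Γ(V)} Γ(V, M)` -/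

section Sections

/-- Sections of isomorphic modules over an open, as an additive equivalence. [folklore] -/
def sectionsAddEquiv {X' : Scheme.{u}} {A B : X'.Modules} (E : A ≅ B) (W : X'.Opens) :
    Γ(A, W) ≃+ Γ(B, W) where
  toFun := E.hom.app W
  invFun := E.inv.app W
  left_inv a := inv_app_hom_app E W a
  right_inv b := hom_app_inv_app E W b
  map_add' a a' := map_add _ a a'

/-- `g_U⁻¹(f⁻¹V) = ⊤`. [folklore] -/
theorem chart_preimage_eq_top (i : U ≤ f ⁻¹ᵁ V) : hU.fromSpec ⁻¹ᵁ (f ⁻¹ᵁ V) = ⊤ :=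
  top_le_iff.mp (hU.fromSpec_preimage_self.symm.trans_le (Scheme.Hom.preimage_mono _ i))

/-- The `Γ(U)`-module `Γ(U) ⊗_{Γ(V)} Γ(V, M)` of the chart (Mathlib's `extendScalars` along `f♯`,
applied to `Γ(V, M)` in the form `Γ(M|_{Spec Γ(V)}, ⊤)`). [folklore] -/
abbrev chartTensor : ModuleCat.{u} Γ(X, U) :=
  (ModuleCat.extendScalars.{u, u, u} (chartHom f i).hom).obj (restrictTop M hV)

/-- **`Γ(U) ⊗_{Γ(V)} Γ(V, M) ≃ Γ(U, f^*M)`** (additively; `Γ(U)`-linear by `chartSectionsEquiv_smul`):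
global sections of the chart isomorphism `chartIso`. [cite: GortzWedhorn2020, Prop 7.24 (2)] -/
def chartSectionsEquiv (hM : IsAffineLocalizing M) :
    chartTensor f M hV i ≃+ Γ((Scheme.Modules.pullback f).obj M, U) :=
  (tilde.isoTop (chartTensor f M hV i)).toLinearEquiv.toAddEquiv.trans <|
    (sectionsAddEquiv (chartIso f M hV hU i hM) ⊤).symm.trans
      (((Scheme.Modules.pullback f).obj M).presheaf.mapIso
        (eqToIso (fromSpec_image_top hU).symm).op).addCommGroupIsoToAddEquiv

/-- The chart isomorphism at `⊤` on the pulled-back section `η(m)|_{g_U(⊤)}`. [folklore] -/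
theorem chartIso_hom_app_top_unit (hM : IsAffineLocalizing M) (m : Γ(M, V)) :
    (chartIso f M hV hU i hM).hom.app ⊤
      (((Scheme.Modules.pullback f).obj M).presheaf.map
        (homOfLE ((hU.fromSpec.image_le_opensRange ⊤).trans
          (hU.opensRange_fromSpec.le.trans i))).op (unitSection f M V m)) =
      tilde.toOpen (chartTensor f M hV i) ⊤
        ((1 : Γ(X, U)) ⊗ₜ[Γ(Y, V), (chartHom f i).hom] (appTopRestrictFromSpecEquiv M hV m)) := by
  have hO := chart_preimage_eq_top f hU i
  -- compare after restriction to `O₁ = g_U⁻¹(f⁻¹V)` (`= ⊤`), where `chartIso_hom_app_unit` applies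
  have hinj : Function.Injective
      ((tilde (chartTensor f M hV i)).presheaf.map (eqToHom hO).op) :=
    ((tilde (chartTensor f M hV i)).presheaf.mapIso (eqToIso hO).op).addCommGroupIsoToAddEquiv.injective
  apply hinj
  rw [← Scheme.Modules.Hom.app_map_apply]
  have h := chartIso_hom_app_unit f M hV hU i hM m
  have s8 := congrArg (fun φ => (ModuleCat.Hom.hom φ)
      ((1 : Γ(X, U)) ⊗ₜ[Γ(Y, V), (chartHom f i).hom] (appTopRestrictFromSpecEquiv M hV m)))
    (tilde.toOpen_res (chartTensor f M hV i) ⊤ (hU.fromSpec ⁻¹ᵁ (f ⁻¹ᵁ V)) (eqToHom hO))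
  simp only [ModuleCat.hom_comp, LinearMap.comp_apply] at s8
  refine Eq.trans ?_ (h.trans s8.symm)
  congr 1
  change (((Scheme.Modules.pullback f).obj M).presheaf.map _)
    ((((Scheme.Modules.pullback f).obj M).presheaf.map _) (unitSection f M V m)) = _
  rw [← CategoryTheory.comp_apply, ← Functor.map_comp]
  exact presheaf_map_congr _ _ _ _

/-- **The chart equivalence sends `1 ⊗ m` to `η(m)|_U`.** [cite: GortzWedhorn2020, Prop 7.24 (2) (proof)] -/
theorem chartSectionsEquiv_one_tmul (hM : IsAffineLocalizing M) (m : Γ(M, V)) :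
    chartSectionsEquiv f M hV hU i hM
      ((1 : Γ(X, U)) ⊗ₜ[Γ(Y, V), (chartHom f i).hom] (appTopRestrictFromSpecEquiv M hV m)) =
      unitSectionLE f M i m := by
  have h := chartIso_hom_app_top_unit f M hV hU i hM m
  -- invert `chartIso` at `⊤`
  have h' := inv_app_hom_app (chartIso f M hV hU i hM) ⊤
    (((Scheme.Modules.pullback f).obj M).presheaf.map
      (homOfLE ((hU.fromSpec.image_le_opensRange ⊤).trans
        (hU.opensRange_fromSpec.le.trans i))).op (unitSection f M V m))
  rw [h] at h'
  change (((Scheme.Modules.pullback f).obj M).presheaf.map (eqToHom (fromSpec_image_top hU).symm).op)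
    ((chartIso f M hV hU i hM).inv.app ⊤ (tilde.toOpen (chartTensor f M hV i) ⊤ _)) = _
  rw [h', unitSectionLE]
  change (((Scheme.Modules.pullback f).obj M).presheaf.map _)
    ((((Scheme.Modules.pullback f).obj M).presheaf.map _) (unitSection f M V m)) = _
  rw [← CategoryTheory.comp_apply, ← Functor.map_comp]
  exact presheaf_map_congr _ _ _ _

/-- The `Γ(U)`-action on the global sections of a module `K` on `Spec Γ(U)`, transported to
`Γ(K, g_U(⊤)) → Γ(K, U)`... : moving a section of `N|_{Spec Γ(U)}` over `⊤` to `Γ(N, U)` is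
`Γ(U)`-linear. [folklore] -/
theorem map_eqToHom_smul_restrict_top (N : X.Modules) (c : Γ(X, U)) (x : Γ(N.restrict hU.fromSpec, ⊤)) :
    N.presheaf.map (eqToHom (fromSpec_image_top hU).symm).op
        (show Γ(N, hU.fromSpec ''ᵁ ⊤) from c • x) =
      c • N.presheaf.map (eqToHom (fromSpec_image_top hU).symm).op (show Γ(N, hU.fromSpec ''ᵁ ⊤) from x) := by
  rw [restrict_fromSpec_smul_def hU N ⊤ c x, Scheme.Modules.map_smul]
  congr 1
  rw [← CategoryTheory.comp_apply, ← Functor.map_comp]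
  exact (congrArg (fun j => X.presheaf.map j c) (Subsingleton.elim _ (𝟙 _))).trans
    (by rw [X.presheaf.map_id]; rfl)

/-- **The chart equivalence is `Γ(U)`-linear.** [folklore] -/
theorem chartSectionsEquiv_smul (hM : IsAffineLocalizing M) (c : Γ(X, U)) (q : chartTensor f M hV i) :
    chartSectionsEquiv f M hV hU i hM (c • q) = c • chartSectionsEquiv f M hV hU i hM q := by
  change (((Scheme.Modules.pullback f).obj M).presheaf.map (eqToHom (fromSpec_image_top hU).symm).op)
      ((chartIso f M hV hU i hM).inv.app ⊤ (tilde.toOpen (chartTensor f M hV i) ⊤ (c • q))) =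
    c • (((Scheme.Modules.pullback f).obj M).presheaf.map (eqToHom (fromSpec_image_top hU).symm).op)
      ((chartIso f M hV hU i hM).inv.app ⊤ (tilde.toOpen (chartTensor f M hV i) ⊤ q))
  rw [← map_eqToHom_smul_restrict_top hU]
  congr 1
  rw [map_smul, Scheme.Modules.smul_Spec_def, Scheme.Modules.smul_Spec_def,
    Scheme.Modules.Hom.app_smul]

/-- **`m ↦ η(m)|_U` factors as `Γ(V, M) ≃ Γ(M|_{Spec Γ(V)}, ⊤) → Γ(U) ⊗ Γ(V, M) ≃ Γ(U, f^*M)`.**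
[folklore] -/
theorem unitSectionLE_eq_comp (hM : IsAffineLocalizing M) :
    unitSectionLE f M i = chartSectionsEquiv f M hV hU i hM ∘
      (fun p : restrictTop M hV => (1 : Γ(X, U)) ⊗ₜ[Γ(Y, V), (chartHom f i).hom] p) ∘
        appTopRestrictFromSpecEquiv M hV := by
  funext m
  exact (chartSectionsEquiv_one_tmul f M hV hU i hM m).symm

/-- **Bijectivity criterion**: if `p ↦ 1 ⊗ p : Γ(V, M) → Γ(U) ⊗_{Γ(V)} Γ(V, M)` is bijective (e.g.
`Γ(V) → Γ(U)` surjective with kernel killing `Γ(V, M)`, or an isomorphism modulo an ideal killing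
`Γ(V, M)`), then so is `m ↦ η(m)|_U : Γ(V, M) → Γ(U, f^*M)`. [folklore] -/
theorem unitSectionLE_bijective_of (hU : IsAffineOpen U) (hM : IsAffineLocalizing M)
    (h1 : Function.Bijective
      (fun p : restrictTop M hV => (1 : Γ(X, U)) ⊗ₜ[Γ(Y, V), (chartHom f i).hom] p)) :
    Function.Bijective (unitSectionLE f M i) := by
  rw [unitSectionLE_eq_comp f M hV hU i hM]
  exact (chartSectionsEquiv f M hV hU i hM).bijective.comp
    (h1.comp (appTopRestrictFromSpecEquiv M hV).bijective)

end Sections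

end Literature.AlgebraicGeometry.Modules

end
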